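import Summits.ResolutionOfSingularities.ResolutionOfSingularities.Theorems.FrobeniusLadderFInjectiveMacaulayficationFullLastCentreFibre
import HarnessLib

/-!
# K10l — THE EXACT SLACK LEDGER: `ρ ≤ 8 + Σ_{E ∋ x} τ_E` at every budgeted point, with the slack of each exceptional letter FIXED AT ITS CREATION by
# `τ_new = (2·|Nor| − ν_Z) + Σ_{older E ⊇ Z} τ_E` and carried unchanged through later charts and fibre translations
# (crux `FInjectiveMacaulayfication` stmt-ResolutionOfSingularities-15315, chain w45a; the «LOW-ORDER LEDGER» row of `Lines/T-register.md` rev 14 (desk R26.40/R26.44) in the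
# kernel: the cap question for NON-ω-permissible rules is reduced to bounding the accumulated positive slack; seat res-L1-w45a-lead-1 g16)

[OURS · L1 W4.5a] Support file (`--supports stmt-ResolutionOfSingularities-15315 --as helper`); replaces the role of NO printed item; NOT a statement of any manuscript;
proves nothing of the crux; OURS counted 0. AI-written (AI review is weaker than expert review).

THE LEDGER. For a stage `S` with residual decomposition `Disc = y^α·N` put `τ_n := 2·d_n − α_n` (the SLACK of the exceptional letter `n`; K10f's `AllSlackLE` is
`τ ≤ 0`). (1) ★ `exists_le_budget_add_slack`: the drop-point budget gives a monomial of `N` of degree `≤ 8 + Σ_{n ∈ Exc} τ_n` EXACTLY (not only `Σ τ⁺`): `ρ ≤ 8 + Σ τ`.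
(2) ★ `slack_step_self` / `slack_step_ne`: through a chart of the blow-up of `Z = V(x, y_Nor)` with minimal normal degree `ν`, the OLD letters keep their slack and the
NEW letter gets `τ_L = (2·|Nor| − ν) + Σ_{n ∈ Exc ∩ Nor} τ_n` (K10f `alpha_general_step` + the defect rule of `IsChart`). (3) `slack_translate`: at a fibre point the
surviving letters keep their slack. CONSEQUENCE (the register's LOW-ORDER LEDGER, quantified and typed): along any chain, `ρ_final ≤ 8 + Σ_{E ∋ x_final} τ_E`, each `τ_E`
computed once, at the creation of `E`, from the codimension and the minimal normal degree of its centre and the slacks of the older letters containing the centre; a step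
with `ν_Z ≥ 2·|Nor|` from non-positive slacks creates a non-positive slack (K10f), an ω-permissible step of low order is covered by the no-rise laws (K10g/K10j), and a
NON-ω-permissible low-order step is the only event that can put positive slack on the ledger. Exponent bookkeeping only; no named fact.
-/

-- single-problem summit: the doubled namespace component is forced
set_option linter.dupNamespace false

noncomputable section

open MvPolynomial Finsupp
open Summit.ResolutionOfSingularities.ResolutionOfSingularities.Theorems.FInjectiveMacaulayfication.LastCentreDefs
open Summit.ResolutionOfSingularities.ResolutionOfSingularities.Theorems.FInjectiveMacaulayfication.LastCentreAxisOrder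
open Summit.ResolutionOfSingularities.ResolutionOfSingularities.Theorems.FInjectiveMacaulayfication.LastCentreSlack
open Summit.ResolutionOfSingularities.ResolutionOfSingularities.Theorems.FInjectiveMacaulayfication.LastCentreTame
open Summit.ResolutionOfSingularities.ResolutionOfSingularities.Theorems.FInjectiveMacaulayfication.LastCentreTranslate

namespace Summit.ResolutionOfSingularities.ResolutionOfSingularities.Theorems.FInjectiveMacaulayfication.LastCentreLedger

variable {k : Type} [Field k]

/-- THE SLACK of the exceptional letter `n` at a stage with residual exponent `α`: `τ_n = 2·d_n − α_n`. [OURS · L1 W4.5a · definition] -/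
def slack (S : Stage k) (α : Expo) (n : Letter) : ℤ := 2 * S.d n - (α n : ℤ)

/-- `AllSlackLE` (K10f) is «all slacks non-positive». [plumbing] -/
theorem allSlackLE_iff (S : Stage k) (α : Expo) : AllSlackLE S α ↔ ∀ n ∈ S.Exc, slack S α n ≤ 0 := by
  unfold AllSlackLE slack
  exact ⟨fun h n hn => by have := h n hn; omega, fun h n hn => by have := h n hn; omega⟩

/-- `|α| = Σ_{n ∈ Exc} α_n` when `α` vanishes off `Exc`. [plumbing] -/
theorem tdeg_eq_sum_of_off {Exc : Finset Letter} {α : Expo} (h : ∀ n, n ∉ Exc → α n = 0) : tdeg α = ∑ n ∈ Exc, α n := by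
  unfold tdeg
  exact (Finset.sum_subset (Finset.subset_univ Exc) fun n _ hn => h n hn).symm

/-- ★ THE CAP WITH THE EXACT LEDGER: the drop-point budget `ord₀ Disc ≤ 8 + 2·Σ d_n` and `Disc = y^α·N` give a monomial of `N` of degree `≤ 8 + Σ_{n ∈ Exc} τ_n`.
[OURS · L1 W4.5a] -/
theorem exists_le_budget_add_slack {S : Stage k} {α : Expo} {N : YPoly k} (hres : IsResidual S.Exc S.D α N) (hbud : DropBudget S) :
    ∃ e ∈ N.support, (tdeg e : ℤ) ≤ 8 + ∑ n ∈ S.Exc, slack S α n := by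
  obtain ⟨e, he, hb⟩ := exists_residual_le_of_budget hres hbud
  refine ⟨e, he, ?_⟩
  have hα : (tdeg α : ℤ) = ∑ n ∈ S.Exc, (α n : ℤ) := by rw [tdeg_eq_sum_of_off hres.2.1]; push_cast; rfl
  have hs : ∑ n ∈ S.Exc, slack S α n = 2 * ∑ n ∈ S.Exc, S.d n - ∑ n ∈ S.Exc, (α n : ℤ) := by
    unfold slack; rw [Finset.sum_sub_distrib, Finset.mul_sum]
  rw [hs]; omega

/-- The cap as an `OrdLE` statement: `ρ ≤ ⌊8 + Σ τ⌋₊`. [OURS · L1 W4.5a] -/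
theorem ordLE_budget_add_slack {S : Stage k} {α : Expo} {N : YPoly k} (hres : IsResidual S.Exc S.D α N) (hbud : DropBudget S) :
    OrdLE N (8 + ∑ n ∈ S.Exc, slack S α n).toNat := by
  obtain ⟨e, he, hb⟩ := exists_le_budget_add_slack hres hbud
  exact ⟨e, he, by omega⟩

/-- ★ THE LEDGER THROUGH A CHART, OLD LETTERS: `τ′_n = τ_n` for `n ≠ L`. [OURS · L1 W4.5a] -/
theorem slack_step_ne {S S' : Stage k} {Nor : Finset Letter} {L : Letter} {α α' : Expo} {N N' : YPoly k} (hL : L ∈ Nor)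
    (hch : IsChart S Nor L S') (hN : IsResidual S.Exc S.D α N) (hN' : IsResidual S'.Exc S'.D α' N')
    {ν : ℕ} (hν₁ : ∃ e ∈ N.support, norDeg Nor e = ν) (hν₂ : ∀ e ∈ N.support, ν ≤ norDeg Nor e) {n : Letter} (hn : n ≠ L) :
    slack S' α' n = slack S α n := by
  obtain ⟨hα'n, -⟩ := alpha_general_step hL hch hN hN' hν₁ hν₂
  unfold slack; rw [hα'n n hn, hch.2.2.2.2.1 n hn]

/-- ★ THE LEDGER THROUGH A CHART, THE NEW LETTER: `τ′_L = (2·|Nor| − ν) + Σ_{n ∈ Exc ∩ Nor} τ_n` (from `α′_L + 6 = ndeg_Z α + ν` and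
`d′_L = (|Nor| + 1 − 4) + Σ_{n ∈ Exc ∩ Nor} d_n`). [OURS · L1 W4.5a] -/
theorem slack_step_self {S S' : Stage k} {Nor : Finset Letter} {L : Letter} {α α' : Expo} {N N' : YPoly k} (hL : L ∈ Nor)
    (hch : IsChart S Nor L S') (hN : IsResidual S.Exc S.D α N) (hN' : IsResidual S'.Exc S'.D α' N')
    {ν : ℕ} (hν₁ : ∃ e ∈ N.support, norDeg Nor e = ν) (hν₂ : ∀ e ∈ N.support, ν ≤ norDeg Nor e) :
    slack S' α' L = (2 * (Nor.card : ℤ) - ν) + ∑ n ∈ S.Exc ∩ Nor, slack S α n := by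
  classical
  obtain ⟨-, hα'L⟩ := alpha_general_step hL hch hN hN' hν₁ hν₂
  have hdL := hch.2.2.2.2.2
  -- ndeg_Z α = Σ_{n ∈ Exc ∩ Nor} α_n (α vanishes off Exc)
  have hnor : (norDeg Nor α : ℤ) = ∑ n ∈ S.Exc ∩ Nor, (α n : ℤ) := by
    unfold norDeg
    rw [← Finset.sum_subset (Finset.inter_subset_right : S.Exc ∩ Nor ⊆ Nor) (fun n hn hni => ?_)]
    · push_cast; rfl
    · exact hN.2.1 n fun hE => hni (Finset.mem_inter.mpr ⟨hE, hn⟩)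
  have hs : ∑ n ∈ S.Exc ∩ Nor, slack S α n = 2 * ∑ n ∈ S.Exc ∩ Nor, S.d n - ∑ n ∈ S.Exc ∩ Nor, (α n : ℤ) := by
    unfold slack; rw [Finset.sum_sub_distrib, Finset.mul_sum]
  rw [hs]
  unfold slack
  rw [hdL, ← hnor]
  have : (α' L : ℤ) + 6 = norDeg Nor α + ν := by exact_mod_cast hα'L
  omega

/-- ★ THE LEDGER AT A FIBRE POINT: the surviving letters keep their slack. [OURS · L1 W4.5a] -/
theorem slack_translate {S S' : Stage k} {c : Letter → k} {α : Expo} {N : YPoly k} (htr : IsTranslate S c S')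
    (hres : IsResidual S.Exc S.D α N) {α' : Expo} {N' : YPoly k} (hres' : IsResidual S'.Exc S'.D α' N') {n : Letter} (hn : n ∈ S'.Exc) :
    slack S' α' n = slack S α n := by
  obtain ⟨hD', hExc', hd'⟩ := htr
  obtain ⟨α₁, U, hres₁, hα₁, -, -, -⟩ := isResidual_translate c hres hExc'
  rw [← hD'] at hres₁
  obtain ⟨hαeq, -⟩ := residual_unique hres₁ hres'
  subst hαeq
  unfold slack; rw [hd' n hn, hα₁ n hn]

/-- THE LOW-ORDER LEDGER, one step: if the old letters through the centre have non-positive slack, the new letter's slack is at most `2·|Nor| − ν` — positive only for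
a LOW-ORDER centre (`ν < 2·|Nor|`). [OURS · L1 W4.5a] -/
theorem slack_step_self_le {S S' : Stage k} {Nor : Finset Letter} {L : Letter} {α α' : Expo} {N N' : YPoly k} (hL : L ∈ Nor)
    (hch : IsChart S Nor L S') (hN : IsResidual S.Exc S.D α N) (hN' : IsResidual S'.Exc S'.D α' N')
    {ν : ℕ} (hν₁ : ∃ e ∈ N.support, norDeg Nor e = ν) (hν₂ : ∀ e ∈ N.support, ν ≤ norDeg Nor e)
    (hold : ∀ n ∈ S.Exc ∩ Nor, slack S α n ≤ 0) : slack S' α' L ≤ 2 * (Nor.card : ℤ) - ν := by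
  rw [slack_step_self hL hch hN hN' hν₁ hν₂]
  have : ∑ n ∈ S.Exc ∩ Nor, slack S α n ≤ 0 := Finset.sum_nonpos hold
  omega

end Summit.ResolutionOfSingularities.ResolutionOfSingularities.Theorems.FInjectiveMacaulayfication.LastCentreLedger

end
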